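import Literature.AlgebraicGeometry.Hu2025.Proofs.S04ModelV.RenderingCountermodels
import Literature.AlgebraicGeometry.Hu2025.Proofs.S04ModelV.GoverningBinomials
import Literature.AlgebraicGeometry.Hu2025.Statements.S04ModelV.R103cClaims
import HarnessLib

/-!
# Hu 2025 §4.2.2, the remark after Ex. 4.14 ‹chunk 4.13› «a ℘-binomial does not admit any non-zero root parent»
# (`C23L47` / `C23L47_R2`, row 103 file c): ROOT PARENTS OF ℘-BINOMIALS on the typed renderings — kernel toolkit and a
# GENERIC TWO-BLOCK CONFIGURATION carrying a NON-ZERO root parent under BOTH readings (file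
# `Proofs/S04ModelV/RootParents.lean`; typer of record res-type-042, row 103)

**HONEST FRAMING (D-0012/D-0089).** Theorems about OUR typed renderings (`R103bDescendants`: `IsDescentStep` /
`IsParentOf` / `IsRootPolynomial` / `IsRootParentOf` = reading R1, res-type-044, cofactors arbitrary; `IsDescentStepR2` / … /
`IsRootParentOfR2` = reading R2, res-type-042, term-wise expressions in `R_[k]`; `R103cClaims`: `C23L47`, `C23L47_R2`). The
preprint [Hu2025] (arXiv:2507.21400v1) stays «under review»; nothing of it is asserted; AI proof is weaker than expert
review; nothing here is progress on resolution of singularities. Locators: chunk p0022 l.153–173, p0023 l.5–48; PDF p.49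
L019–L033, p.50 L003–L027 (`lit/res-lit-6/hu25/text/`).

What is proved (every commutative ring `k` unless «nontrivial» is said; all index data `σ, T, 𝔗, rel, mono`; every `Φ`):
* §1 ROOTS BY EVALUATION. A polynomial `f` has a one-step parent at the block `H` only if `f` lies in the ideal generated
  by the chart monomials `x̄_h`, `h ∈ H` (the printed «Set `f̄ = Σ_i x_{u_i}x_{v_i} n_i`»). Kernel form: if a `k`-algebra
  map `ψ_v` (ϖ-variables `x_s ↦ v s`, ϱ-variables fixed) kills some ϖ-variable of every `x̄_h`, `h ∈ H`, and `ψ_v f ≠ 0`,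
  then NO `g` descends to `f` at `H` (`not_isDescentStep_of_aeval`); a multi-homogeneous `f` with no one-step parent at
  any block is a root polynomial in both readings (`isRootPolynomial_of_no_step`, `isRootPolynomialR2_of_no_step`).
* §2 TWO TERM-WISE DESCENT STEPS (reading R2, hence R1), for ANY `mono`: with terms `i ≠ j` of a block `F ∈ Φ` and
  `g₀ ≠ g₁` of a block `G ∈ Φ`, the polynomial `f_R := x_{g₀} x_i · B_F + x_i² · B_G` (`B_F = wpBinomial i j =
  x̄_j x_i − x̄_i x_j`, `B_G = wpBinomial g₀ g₁`) descends at `G` to `f_M := x̄_{g₀} x_i · B_F` (`isDescentStepR2_rootWitness`),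
  and `f_M` descends at `F` to the ℘-binomial `B_F` (`isDescentStepR2_midWitness`) — both through CANCELLING expressions of
  the kind the text itself uses in Ex. 4.14 (the expression `x_{(u′,v′)}x_{(u,v)} − x_{(u,v)}x_{(u′,v′)}`, «which is zero as
  a binomial», descending to the ℘-binomial). So `f_R` is a parent of `B_F` in both readings (`isParentOfR2_rootWitness`).
* §3 THE TWO-BLOCK CONFIGURATION. If moreover `x̄_i = x_a`, `x̄_j = x_p x_c`, `x̄_{g₀} = x_c`, `x̄_{g₁} = x_{q₁} x_{q₂}` for
  ϖ-variables with `a, p ∉ {q₁, q₂, c}`, every chart monomial of a term OUTSIDE the block `F` contains a ϖ-variable `≠ x_a`,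
  and every chart monomial of a term OF the block `F` contains a ϖ-variable outside `{x_{q₁}, x_{q₂}, x_c}`, then over a
  nontrivial `k` the polynomial `f_R ≠ 0` has NO one-step parent at any block, so it is a NON-ZERO ROOT PARENT of the
  ℘-binomial `B_F` under R1 and under R2 (`rootWitness_spec`), and `¬ C23L47 rel mono Φ`, `¬ C23L47_R2 rel mono Φ`
  (`not_C23L47_of_config`, `not_C23L47_R2_of_config`). The companion file
  `RootParentsPlatformSix.lean` shows that the platform `Gr^{3,6}` (`relN 6`, `monoN 6`, `Φ = univ`: `F = F̄_{(123),(456)}`,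
  `G = F̄_{(123),(356)}`, `x̄_j = x_{124}x_{356}`, `x̄_{g₁} = x_{135}x_{236}`) IS such a configuration.
READING NOTE (for the lanes / res-adj, no side taken): the witness exploits that the typed «parent» relation (either
reading) admits expressions whose written summands cancel, exactly as the printed Ex. 4.14 does; whether the remark p.50 L027
intends a narrower class of expressions (e.g. binomial parents of binomials, cf. p.50 L028–L034 «the first binomial as a root
parent is uniquely determined by the second») is a question about the text, recorded here, not answered.
-/

noncomputable section

namespace Literature.AlgebraicGeometry.Hu2025.Proofs.S04ModelV

open MvPolynomial Literature.AlgebraicGeometry.Hu2025.Statements.S04ModelV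

universe u v w x

variable {k : Type u} [CommRing k] {σ : Type v} {T : Type w} {𝔗 : Type x}

/-! ## §1 Roots by evaluation -/

/-- If the ϖ-assignment `v` kills a ϖ-variable occurring in the chart monomial `x̄_h`, the `k`-algebra map `ψ_v`
(`x_s ↦ v s`, `x_t ↦ x_t`) kills `x̄_h`.
[cite: Hu2025, §4.2.2 Def. 4.11 ‹chunk 4.10› / remark after Ex. 4.14, chunks p0022 l.153–173 / p0023 l.47–48, pp. 49–50 (unrefereed preprint arXiv:2507.21400v1 under adjudication, D-0012/D-0089 — kernel support on OUR typed renderings of row 103; nothing of the source asserted)] -/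
theorem aeval_toModel_img_eq_zero (mono : T → (σ →₀ ℕ)) (v : σ → ModelRing σ T k) {h : T} {s : σ}
    (hs : s ∈ (mono h).support) (hv : v s = 0) :
    aeval (Sum.elim v fun t : T => (X (Sum.inr t) : ModelRing σ T k)) (toModel (T := T) (img (k := k) mono h)) = 0 := by
  unfold toModel img
  rw [aeval_rename]
  have hcomp : (Sum.elim v fun t : T => (X (Sum.inr t) : ModelRing σ T k)) ∘ (Sum.inl : σ → σ ⊕ T) = v := rfl
  rw [hcomp, aeval_monomial, map_one, one_mul, Finsupp.prod]
  apply Finset.prod_eq_zero hs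
  rw [hv]
  exact zero_pow (Finsupp.mem_support_iff.mp hs)

/-- **No one-step parent at the block `H`, by evaluation**: if `ψ_v` kills some ϖ-variable of every chart monomial `x̄_h`,
`rel h = H`, then every `Σ_i x̄_{h_i} n_i` (the printed «`f̄ = Σ_i x_{u_i}x_{v_i} n_i`») is killed by `ψ_v`; so a polynomial
`f` with `ψ_v f ≠ 0` is the descendant at `H` of nothing (reading R1, arbitrary cofactors).
[cite: Hu2025, §4.2.2 Def. 4.11 ‹chunk 4.10› / remark after Ex. 4.14, chunks p0022 l.153–173 / p0023 l.47–48, pp. 49–50 (unrefereed preprint arXiv:2507.21400v1 under adjudication, D-0012/D-0089 — kernel support on OUR typed renderings of row 103; nothing of the source asserted)] -/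
theorem not_isDescentStep_of_aeval [DecidableEq 𝔗] (rel : T → 𝔗) (mono : T → (σ →₀ ℕ)) (v : σ → ModelRing σ T k)
    {H : 𝔗} (hkill : ∀ h : T, rel h = H → ∃ s ∈ (mono h).support, v s = 0) {f : ModelRing σ T k}
    (hf : aeval (Sum.elim v fun t : T => (X (Sum.inr t) : ModelRing σ T k)) f ≠ 0) (g : ModelRing σ T k) :
    ¬ IsDescentStep (k := k) rel mono H g f := by
  rintro ⟨-, l, hl, -, rfl⟩
  apply hf
  rw [map_list_sum, List.map_map]
  apply List.sum_eq_zero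
  intro y hy
  rw [List.mem_map] at hy
  obtain ⟨p, hp, rfl⟩ := hy
  obtain ⟨s, hs, hvs⟩ := hkill p.1 (hl p hp)
  simp only [Function.comp_apply, map_mul]
  rw [aeval_toModel_img_eq_zero mono v hs hvs, zero_mul]

/-- A multi-homogeneous polynomial into which nothing descends (at any block) is a ROOT POLYNOMIAL (reading R1): the parent
relation is the reflexive–transitive closure of one-step descent, so its only parent is itself.
[cite: Hu2025, §4.2.2 Def. 4.11 ‹chunk 4.10› / remark after Ex. 4.14, chunks p0022 l.153–173 / p0023 l.47–48, pp. 49–50 (unrefereed preprint arXiv:2507.21400v1 under adjudication, D-0012/D-0089 — kernel support on OUR typed renderings of row 103; nothing of the source asserted)] -/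
theorem isRootPolynomial_of_no_step [DecidableEq 𝔗] (rel : T → 𝔗) (mono : T → (σ →₀ ℕ)) {f : ModelRing σ T k}
    (hMH : IsMultiHomogeneous (k := k) (σ := σ) rel f)
    (hno : ∀ (H : 𝔗) (g : ModelRing σ T k), ¬ IsDescentStep (k := k) rel mono H g f) :
    IsRootPolynomial (k := k) rel mono f := by
  refine ⟨hMH, fun g hg => ?_⟩
  rcases hg.cases_tail with h | ⟨c, -, ⟨H, hH⟩⟩
  · exact h.symm
  · exact absurd hH (hno H c)

/-- The same for reading R2: a multi-homogeneous `f ∈ R_Φ` into which nothing descends (R1, a fortiori term-wise) is a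
term-wise root polynomial.
[cite: Hu2025, §4.2.2 Def. 4.11 ‹chunk 4.10› / remark after Ex. 4.14, chunks p0022 l.153–173 / p0023 l.47–48, pp. 49–50 (unrefereed preprint arXiv:2507.21400v1 under adjudication, D-0012/D-0089 — kernel support on OUR typed renderings of row 103; nothing of the source asserted)] -/
theorem isRootPolynomialR2_of_no_step [DecidableEq 𝔗] (rel : T → 𝔗) (mono : T → (σ →₀ ℕ)) (Φ : Set 𝔗)
    {f : ModelRing σ T k} (hR : f ∈ RSub (k := k) rel Φ) (hMH : IsMultiHomogeneous (k := k) (σ := σ) rel f)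
    (hno : ∀ (H : 𝔗) (g : ModelRing σ T k), ¬ IsDescentStep (k := k) rel mono H g f) :
    IsRootPolynomialR2 (k := k) rel mono Φ f := by
  refine ⟨hR, hMH, fun g hg => ?_⟩
  rcases hg.cases_tail with h | ⟨c, -, ⟨H, hH⟩⟩
  · exact h.symm
  · exact absurd (isDescentStep_of_R2 rel mono Φ hH) (hno H c)

/-! ## §2 Two term-wise descent steps: `f_R →_G f_M →_F B_F` (any `mono`, any `k`) -/

/-- A monomial whose ϱ-variables all belong to blocks in play lies in `R_Φ`.
[cite: Hu2025, §4.2.2 Def. 4.11 ‹chunk 4.10› / remark after Ex. 4.14, chunks p0022 l.153–173 / p0023 l.47–48, pp. 49–50 (unrefereed preprint arXiv:2507.21400v1 under adjudication, D-0012/D-0089 — kernel support on OUR typed renderings of row 103; nothing of the source asserted)] -/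
theorem monomial_mem_RSub [DecidableEq σ] [DecidableEq T] (rel : T → 𝔗) (Φ : Set 𝔗) (E : σ ⊕ T →₀ ℕ) (c : k)
    (hE : ∀ t : T, (Sum.inr t : σ ⊕ T) ∈ E.support → rel t ∈ Φ) :
    (monomial E c : ModelRing σ T k) ∈ RSub (k := k) rel Φ := by
  by_cases hc : c = 0
  · rw [hc, map_zero]; exact zero_mem _
  unfold RSub
  rw [mem_supported, vars_monomial hc]
  intro y hy
  rcases y with s | t
  · exact Or.inl ⟨s, rfl⟩
  · exact Or.inr ⟨t, hE t hy, rfl⟩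

/-- ϱ-support bookkeeping for the exponents below: `x_(t)` occurs in `e_{t₁} + E` only if `t = t₁` or it occurs in `E`.
[cite: Hu2025, §4.2.2 Def. 4.11 ‹chunk 4.10› / remark after Ex. 4.14, chunks p0022 l.153–173 / p0023 l.47–48, pp. 49–50 (unrefereed preprint arXiv:2507.21400v1 under adjudication, D-0012/D-0089 — kernel support on OUR typed renderings of row 103; nothing of the source asserted)] -/
theorem inr_mem_support_single_add [DecidableEq σ] [DecidableEq T] {t t₁ : T} {E : σ ⊕ T →₀ ℕ}
    (h : (Sum.inr t : σ ⊕ T) ∈ (Finsupp.single (Sum.inr t₁ : σ ⊕ T) 1 + E).support) :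
    t = t₁ ∨ (Sum.inr t : σ ⊕ T) ∈ E.support := by
  by_cases ht : t = t₁
  · exact Or.inl ht
  · right
    rw [Finsupp.mem_support_iff, Finsupp.add_apply,
      Finsupp.single_eq_of_ne (fun e => ht (Sum.inr_injective e)), zero_add] at h
    exact Finsupp.mem_support_iff.mpr h

/-- Chart monomials carry no ϱ-variables: `x_(t) ∉ supp (monoR mono t₃)`.
[cite: Hu2025, §4.2.2 Def. 4.11 ‹chunk 4.10› / remark after Ex. 4.14, chunks p0022 l.153–173 / p0023 l.47–48, pp. 49–50 (unrefereed preprint arXiv:2507.21400v1 under adjudication, D-0012/D-0089 — kernel support on OUR typed renderings of row 103; nothing of the source asserted)] -/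
theorem inr_notMem_support_monoR (mono : T → (σ →₀ ℕ)) (t t₃ : T) :
    (Sum.inr t : σ ⊕ T) ∉ (monoR mono t₃).support := by
  rw [Finsupp.mem_support_iff, not_not]
  exact monoR_apply_inr mono t₃ t

/-- Splitting a monomial at a chart-monomial exponent: `x^{monoR a + E} = x̄_a · x^E` (plumbing for the value computations).
[cite: Hu2025, §4.2.2 Def. 4.11 ‹chunk 4.10› / remark after Ex. 4.14, chunks p0022 l.153–173 / p0023 l.47–48, pp. 49–50 (unrefereed preprint arXiv:2507.21400v1 under adjudication, D-0012/D-0089 — kernel support on OUR typed renderings of row 103; nothing of the source asserted)] -/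
theorem monomial_monoR_add (mono : T → (σ →₀ ℕ)) (a : T) (E : σ ⊕ T →₀ ℕ) (c : k) :
    (monomial (monoR mono a + E) c : ModelRing σ T k) = monomial (monoR mono a) 1 * monomial E c := by
  rw [monomial_mul, one_mul]

section TwoSteps

variable [DecidableEq 𝔗] [DecidableEq σ] [DecidableEq T] (rel : T → 𝔗) (mono : T → (σ →₀ ℕ)) (Φ : Set 𝔗)

/-- **Step `f_R →_G f_M` (reading R2)**: for terms `i, j` of a block `F ∈ Φ` and `g₀, g₁` of a block `G ∈ Φ`, the term-wise
expression `x_{g₀}·(x_i² x̄_j) − x_{g₀}·(x_i x_j x̄_i) + x_{g₀}·(x_i² x̄_{g₁}) − x_{g₁}·(x_i² x̄_{g₀})` over the block `G` is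
multi-homogeneous (common multidegree `2e_F + e_G`), lies in `R_Φ`, has the value
`f_R = x_{g₀} x_i (x̄_j x_i − x̄_i x_j) + x_i² (x̄_{g₁} x_{g₀} − x̄_{g₀} x_{g₁})`, and descends («`x_{g} ↦ x̄_{g}`») to
`f_M = x̄_{g₀} x_i (x̄_j x_i − x̄_i x_j)` — its last two written summands cancel after descent, as in the printed Ex. 4.14.
[cite: Hu2025, §4.2.2 Def. 4.11 ‹chunk 4.10› / Ex. 4.14 ‹chunk 4.13› (4.10), chunks p0022 l.153–173 / p0023 l.35–48, pp. 49–50 (unrefereed preprint arXiv:2507.21400v1 under adjudication, D-0012/D-0089 — kernel support on OUR typed renderings of row 103; nothing of the source asserted)] -/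
theorem isDescentStepR2_rootWitness {i j g₀ g₁ : T} (hij : rel j = rel i) (hg : rel g₁ = rel g₀) (hiΦ : rel i ∈ Φ)
    (hgΦ : rel g₀ ∈ Φ) :
    IsDescentStepR2 (k := k) rel mono Φ (rel g₀)
      (rhoVar (k := k) (σ := σ) g₀ * rhoVar (k := k) (σ := σ) i * wpBinomial (k := k) (σ := σ) mono i j +
        rhoVar (k := k) (σ := σ) i * rhoVar (k := k) (σ := σ) i * wpBinomial (k := k) (σ := σ) mono g₀ g₁)
      (toModel (T := T) (img (k := k) mono g₀) * rhoVar (k := k) (σ := σ) i * wpBinomial (k := k) (σ := σ) mono i j) := by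
  refine ⟨[(g₀, Finsupp.single (Sum.inr i) 1 + (Finsupp.single (Sum.inr i) 1 + monoR mono j), 1),
      (g₀, Finsupp.single (Sum.inr i) 1 + (Finsupp.single (Sum.inr j) 1 + monoR mono i), -1),
      (g₀, Finsupp.single (Sum.inr i) 1 + (Finsupp.single (Sum.inr i) 1 + monoR mono g₁), 1),
      (g₁, Finsupp.single (Sum.inr i) 1 + (Finsupp.single (Sum.inr i) 1 + monoR mono g₀), -1)], ?_, ?_, ?_⟩
  · -- a multi-homogeneous expression over the block `G = rel g₀` in `R_Φ`, multidegree `2 e_F + e_G`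
    refine ⟨fun H => (if rel g₀ = H then 1 else 0) + ((if rel i = H then 1 else 0) + (if rel i = H then 1 else 0)), ?_⟩
    intro p hp
    simp only [List.mem_cons, List.not_mem_nil, or_false] at hp
    have hΦ : ∀ t : T, t = g₀ ∨ t = g₁ ∨ t = i ∨ t = j → rel t ∈ Φ := by
      rintro t (rfl | rfl | rfl | rfl)
      · exact hgΦ
      · rw [hg]; exact hgΦ
      · exact hiΦ
      · rw [hij]; exact hiΦ
    rcases hp with rfl | rfl | rfl | rfl <;> refine ⟨by simp [hg], ?_, ?_⟩ <;>
      (try (rw [exprSummand_eq]; apply monomial_mem_RSub; intro t ht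
            rcases inr_mem_support_single_add ht with rfl | ht
            · apply hΦ; simp
            rcases inr_mem_support_single_add ht with rfl | ht
            · apply hΦ; simp
            rcases inr_mem_support_single_add ht with rfl | ht
            · apply hΦ; simp
            exact absurd ht (inr_notMem_support_monoR mono _ _))) <;>
      (intro H; rw [exprSummand_eq]; apply isWeightedHomogeneous_monomial
       simp only [weight_exprSummand_exp, weight_blockWeight_monoR, add_zero, hij, hg])
  · -- the value is `f_R`
    simp only [List.map_cons, List.map_nil, List.sum_cons, List.sum_nil, exprSummand_eq, monomial_single_add,
      pow_one, map_neg, rhoVar, wpBinomial, toModel_img]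
    ring
  · -- the descended value is `f_M`
    simp only [List.map_cons, List.map_nil, List.sum_cons, List.sum_nil, exprSummandBar, monomial_single_add,
      pow_one, map_neg, rhoVar, wpBinomial, toModel_img]
    ring

/-- **Step `f_M →_F B_F` (reading R2)**: the term-wise expression `x_j·(x_i) − x_i·(x_j) + x_i·(x_i x̄_{g₀} x̄_j) −
x_j·(x_i x̄_{g₀} x̄_i)` over the block `F = rel i` is multi-homogeneous (multidegree `2e_F`), lies in `R_Φ`, has the value
`f_M = x̄_{g₀} x_i (x̄_j x_i − x̄_i x_j)` (its first two summands cancel, exactly the printed expression (4.10) of Ex. 4.14),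
and descends to the ℘-binomial `B_F = x̄_j x_i − x̄_i x_j` (its last two summands cancel after descent).
[cite: Hu2025, §4.2.2 Def. 4.11 ‹chunk 4.10› / Ex. 4.14 ‹chunk 4.13› (4.10), chunks p0022 l.153–173 / p0023 l.35–48, pp. 49–50 (unrefereed preprint arXiv:2507.21400v1 under adjudication, D-0012/D-0089 — kernel support on OUR typed renderings of row 103; nothing of the source asserted)] -/
theorem isDescentStepR2_midWitness {i j : T} (g₀ : T) (hij : rel j = rel i) (hiΦ : rel i ∈ Φ) :
    IsDescentStepR2 (k := k) rel mono Φ (rel i)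
      (toModel (T := T) (img (k := k) mono g₀) * rhoVar (k := k) (σ := σ) i * wpBinomial (k := k) (σ := σ) mono i j)
      (wpBinomial (k := k) (σ := σ) mono i j) := by
  refine ⟨[(j, Finsupp.single (Sum.inr i) 1 + 0, 1), (i, Finsupp.single (Sum.inr j) 1 + 0, -1),
      (i, Finsupp.single (Sum.inr i) 1 + (monoR mono g₀ + monoR mono j), 1),
      (j, Finsupp.single (Sum.inr i) 1 + (monoR mono g₀ + monoR mono i), -1)], ?_, ?_, ?_⟩
  · refine ⟨fun H => (if rel i = H then 1 else 0) + (if rel i = H then 1 else 0), ?_⟩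
    intro p hp
    simp only [List.mem_cons, List.not_mem_nil, or_false] at hp
    have hΦ : ∀ t : T, t = i ∨ t = j → rel t ∈ Φ := by
      rintro t (rfl | rfl)
      · exact hiΦ
      · rw [hij]; exact hiΦ
    rcases hp with rfl | rfl | rfl | rfl <;> refine ⟨by simp [hij], ?_, ?_⟩ <;>
      (try (rw [exprSummand_eq]; apply monomial_mem_RSub; intro t ht
            rcases inr_mem_support_single_add ht with rfl | ht
            · apply hΦ; simp
            rcases inr_mem_support_single_add ht with rfl | ht
            · apply hΦ; simp
            exfalso
            rw [Finsupp.support_zero] at ht <;> simp at ht)) <;>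
      (try (rw [exprSummand_eq]; apply monomial_mem_RSub; intro t ht
            rcases inr_mem_support_single_add ht with rfl | ht
            · apply hΦ; simp
            rcases inr_mem_support_single_add ht with rfl | ht
            · apply hΦ; simp
            exfalso
            rcases Finset.mem_union.mp (Finsupp.support_add ht) with h1 | h1 <;>
              exact inr_notMem_support_monoR mono _ _ h1)) <;>
      (intro H; rw [exprSummand_eq]; apply isWeightedHomogeneous_monomial
       simp only [map_add, weight_blockWeight_single, weight_blockWeight_monoR, add_zero, hij])
  · simp only [List.map_cons, List.map_nil, List.sum_cons, List.sum_nil, exprSummand_eq, monomial_single_add,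
      monomial_monoR_add, monomial_zero', pow_one, map_neg, map_one, rhoVar, wpBinomial, toModel_img]
    ring
  · simp only [List.map_cons, List.map_nil, List.sum_cons, List.sum_nil, exprSummandBar, monomial_single_add,
      monomial_monoR_add, monomial_zero', pow_one, map_neg, map_one, rhoVar, wpBinomial, toModel_img]
    ring

end TwoSteps

/-- **`f_R` is a parent of the ℘-binomial `B_F` — reading R2** (two term-wise steps), hence reading R1 (`isParentOf_of_R2`).
[cite: Hu2025, §4.2.2 Def. 4.11 ‹chunk 4.10› / Ex. 4.14 ‹chunk 4.13› (4.10), chunks p0022 l.153–173 / p0023 l.35–48, pp. 49–50 (unrefereed preprint arXiv:2507.21400v1 under adjudication, D-0012/D-0089 — kernel support on OUR typed renderings of row 103; nothing of the source asserted)] -/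
theorem isParentOfR2_rootWitness [DecidableEq 𝔗] [DecidableEq σ] [DecidableEq T] (rel : T → 𝔗)
    (mono : T → (σ →₀ ℕ)) (Φ : Set 𝔗) {i j g₀ g₁ : T} (hij : rel j = rel i) (hg : rel g₁ = rel g₀)
    (hiΦ : rel i ∈ Φ) (hgΦ : rel g₀ ∈ Φ) :
    IsParentOfR2 (k := k) rel mono Φ
      (rhoVar (k := k) (σ := σ) g₀ * rhoVar (k := k) (σ := σ) i * wpBinomial (k := k) (σ := σ) mono i j +
        rhoVar (k := k) (σ := σ) i * rhoVar (k := k) (σ := σ) i * wpBinomial (k := k) (σ := σ) mono g₀ g₁)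
      (wpBinomial (k := k) (σ := σ) mono i j) :=
  (Relation.ReflTransGen.single ⟨rel g₀, isDescentStepR2_rootWitness rel mono Φ hij hg hiΦ hgΦ⟩).tail
    ⟨rel i, isDescentStepR2_midWitness rel mono Φ g₀ hij hiΦ⟩

/-! ## §3 The two-block configuration: `f_R` is a NON-ZERO ROOT PARENT of `B_F` (both readings) -/

section Config

variable [DecidableEq 𝔗] [DecidableEq σ] [DecidableEq T] [Nontrivial k] (rel : T → 𝔗) (mono : T → (σ →₀ ℕ))
  (Φ : Set 𝔗) {i j g₀ g₁ : T} {a p c q₁ q₂ : σ}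
  (hij : rel j = rel i) (hg : rel g₁ = rel g₀) (hiΦ : rel i ∈ Φ) (hgΦ : rel g₀ ∈ Φ) (hne : i ≠ j) (hgne : g₀ ≠ g₁)
  (hFG : rel g₀ ≠ rel i)
  (hmi : mono i = Finsupp.single a 1) (hmj : mono j = Finsupp.single p 1 + Finsupp.single c 1)
  (hmg₀ : mono g₀ = Finsupp.single c 1) (hmg₁ : mono g₁ = Finsupp.single q₁ 1 + Finsupp.single q₂ 1)
  (hca : c ≠ a) (hq₁a : q₁ ≠ a) (hq₂a : q₂ ≠ a) (hpq₁ : p ≠ q₁) (hpq₂ : p ≠ q₂) (hpc : p ≠ c)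
  (HA : ∀ h : T, rel h ≠ rel i → ∃ s ∈ (mono h).support, s ≠ a)
  (HB : ∀ h : T, rel h = rel i → ∃ s ∈ (mono h).support, s ≠ q₁ ∧ s ≠ q₂ ∧ s ≠ c)

include hg hmi hmj hmg₀ hmg₁ hca hq₁a hq₂a hpq₁ hpq₂ hpc hgne hFG HA HB in
/-- **In the two-block configuration NOTHING DESCENDS TO `f_R`** (reading R1, arbitrary cofactors, any block): at a block
`H ≠ F` use `ψ_A` (every ϖ-variable but `x_a` killed; it kills every `x̄_h`, `rel h ≠ F`, and `ψ_A f_R = −x_{g₀} x_i x_j x_a`);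
at `H = F` use `ψ_B` (only `x_{q₁}, x_{q₂}, x_c` kept; it kills every `x̄_h`, `rel h = F`, and
`ψ_B f_R = x_i² (x_{q₁} x_{q₂} x_{g₀} − x_c x_{g₁})`).
[cite: Hu2025, §4.2.2 Def. 4.11 ‹chunk 4.10› / remark after Ex. 4.14, chunks p0022 l.153–173 / p0023 l.47–48, pp. 49–50 (unrefereed preprint arXiv:2507.21400v1 under adjudication, D-0012/D-0089 — kernel support on OUR typed renderings of row 103; nothing of the source asserted)] -/
theorem not_isDescentStep_rootWitness (H : 𝔗) (g : ModelRing σ T k) :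
    ¬ IsDescentStep (k := k) rel mono H g
      (rhoVar (k := k) (σ := σ) g₀ * rhoVar (k := k) (σ := σ) i * wpBinomial (k := k) (σ := σ) mono i j +
        rhoVar (k := k) (σ := σ) i * rhoVar (k := k) (σ := σ) i * wpBinomial (k := k) (σ := σ) mono g₀ g₁) := by
  -- the four chart monomials as products of ϖ-variables
  have hxi : (toModel (T := T) (img (k := k) mono i) : ModelRing σ T k) = X (Sum.inl a) := by
    rw [toModel_img, monoR, hmi, Finsupp.mapDomain_single]; rfl
  have hxj : (toModel (T := T) (img (k := k) mono j) : ModelRing σ T k) = X (Sum.inl p) * X (Sum.inl c) := by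
    rw [toModel_img, monoR, hmj, Finsupp.mapDomain_add, Finsupp.mapDomain_single, Finsupp.mapDomain_single,
      monomial_single_add, pow_one]; rfl
  have hxg₀ : (toModel (T := T) (img (k := k) mono g₀) : ModelRing σ T k) = X (Sum.inl c) := by
    rw [toModel_img, monoR, hmg₀, Finsupp.mapDomain_single]; rfl
  have hxg₁ : (toModel (T := T) (img (k := k) mono g₁) : ModelRing σ T k) = X (Sum.inl q₁) * X (Sum.inl q₂) := by
    rw [toModel_img, monoR, hmg₁, Finsupp.mapDomain_add, Finsupp.mapDomain_single, Finsupp.mapDomain_single,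
      monomial_single_add, pow_one]; rfl
  have hig₁ : i ≠ g₁ := fun h => hFG (by rw [← hg, ← h])
  have hig₀ : i ≠ g₀ := fun h => hFG (by rw [← h])
  by_cases hH : H = rel i
  · -- `ψ_B`: keep `x_{q₁}, x_{q₂}, x_c`
    subst hH
    refine not_isDescentStep_of_aeval rel mono
      (fun s => if s = q₁ ∨ s = q₂ ∨ s = c then X (Sum.inl s) else 0) (fun h hh => ?_) ?_ g
    · obtain ⟨s, hs, h1, h2, h3⟩ := HB h hh
      exact ⟨s, hs, by simp [h1, h2, h3]⟩
    · intro h0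
      have h1 := congrArg (eval fun y : σ ⊕ T => if y = Sum.inr g₁ then (0 : k) else 1) h0
      have hac : ¬ (a = q₁ ∨ a = q₂ ∨ a = c) := by
        rintro (h | h | h)
        · exact hq₁a h.symm
        · exact hq₂a h.symm
        · exact hca h.symm
      have hpc' : ¬ (p = q₁ ∨ p = q₂ ∨ p = c) := by
        rintro (h | h | h)
        · exact hpq₁ h
        · exact hpq₂ h
        · exact hpc h
      simp [wpBinomial, rhoVar, hxi, hxj, hxg₀, hxg₁, hac, hpc', hgne, hig₁] at h1
  · -- `ψ_A`: keep `x_a` only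
    refine not_isDescentStep_of_aeval rel mono (fun s => if s = a then X (Sum.inl s) else 0)
      (fun h hh => ?_) ?_ g
    · obtain ⟨s, hs, hsa⟩ := HA h (hh ▸ hH)
      exact ⟨s, hs, by simp [hsa]⟩
    · intro h0
      have h1 := congrArg (eval fun _ : σ ⊕ T => (1 : k)) h0
      simp [wpBinomial, rhoVar, hxi, hxj, hxg₀, hxg₁, hca, hq₁a, hq₂a] at h1

include hij hg hiΦ hgΦ hmi hmj hmg₀ hmg₁ hca hq₁a hq₂a hpq₁ hpq₂ hpc hne hgne hFG HA HB in
/-- **THE TWO-BLOCK CONFIGURATION CARRIES A NON-ZERO ROOT PARENT OF A ℘-BINOMIAL, under reading R1 AND reading R2**: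
`B_F = wpBinomial mono i j ∈ B^℘_Φ`, `f_R ≠ 0`, `IsRootParentOf rel mono f_R B_F` and `IsRootParentOfR2 rel mono Φ f_R B_F`.
[cite: Hu2025, §4.2.2 remark after Ex. 4.14 ‹chunk 4.13› «a ℘-binomial does not admit any non-zero root parent», chunk p0023 l.47–48, p.50 L027 (unrefereed preprint arXiv:2507.21400v1 under adjudication, D-0012/D-0089 — kernel countermodel to OUR typed renderings `C23L47`/`C23L47_R2` of row 103 on a configuration the platform realises; nothing of the source asserted)] -/
theorem rootWitness_spec :
    wpBinomial (k := k) (σ := σ) mono i j ∈ wpBinomials (k := k) rel mono Φ ∧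
    (rhoVar (k := k) (σ := σ) g₀ * rhoVar (k := k) (σ := σ) i * wpBinomial (k := k) (σ := σ) mono i j +
        rhoVar (k := k) (σ := σ) i * rhoVar (k := k) (σ := σ) i * wpBinomial (k := k) (σ := σ) mono g₀ g₁) ≠ 0 ∧
    IsRootParentOf (k := k) rel mono
      (rhoVar (k := k) (σ := σ) g₀ * rhoVar (k := k) (σ := σ) i * wpBinomial (k := k) (σ := σ) mono i j +
        rhoVar (k := k) (σ := σ) i * rhoVar (k := k) (σ := σ) i * wpBinomial (k := k) (σ := σ) mono g₀ g₁)
      (wpBinomial (k := k) (σ := σ) mono i j) ∧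
    IsRootParentOfR2 (k := k) rel mono Φ
      (rhoVar (k := k) (σ := σ) g₀ * rhoVar (k := k) (σ := σ) i * wpBinomial (k := k) (σ := σ) mono i j +
        rhoVar (k := k) (σ := σ) i * rhoVar (k := k) (σ := σ) i * wpBinomial (k := k) (σ := σ) mono g₀ g₁)
      (wpBinomial (k := k) (σ := σ) mono i j) := by
  have hstep := isDescentStepR2_rootWitness (k := k) rel mono Φ hij hg hiΦ hgΦ
  have hMH := (isDescentStep_of_R2 rel mono Φ hstep).1
  have hR : (rhoVar (k := k) (σ := σ) g₀ * rhoVar (k := k) (σ := σ) i * wpBinomial (k := k) (σ := σ) mono i j +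
      rhoVar (k := k) (σ := σ) i * rhoVar (k := k) (σ := σ) i * wpBinomial (k := k) (σ := σ) mono g₀ g₁) ∈
      RSub (k := k) rel Φ := by
    obtain ⟨l, hl, hf, -⟩ := hstep
    rw [hf]
    exact sum_exprSummand_mem_RSub rel Φ hl
  have hno := not_isDescentStep_rootWitness (k := k) rel mono (i := i) (j := j) hg hgne hFG hmi hmj hmg₀ hmg₁ hca
    hq₁a hq₂a hpq₁ hpq₂ hpc HA HB
  have hpar := isParentOfR2_rootWitness (k := k) rel mono Φ hij hg hiΦ hgΦ
  refine ⟨⟨i, j, hij.symm, hne, hiΦ, rfl, wpBinomial_ne_zero mono hne⟩, ?_,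
    ⟨isRootPolynomial_of_no_step rel mono hMH hno, isParentOf_of_R2 rel mono Φ hpar⟩,
    ⟨isRootPolynomialR2_of_no_step rel mono Φ hR hMH hno, hpar⟩⟩
  -- `f_R ≠ 0`: something descends to `0` at every block (the empty expression), nothing descends to `f_R`
  intro h0
  apply hno (rel i) 0
  rw [h0]
  exact ⟨fun G => ⟨0, isWeightedHomogeneous_zero _ _ _⟩, [], by simp, by simp, by simp⟩

include hij hg hiΦ hgΦ hmi hmj hmg₀ hmg₁ hca hq₁a hq₂a hpq₁ hpq₂ hpc hne hgne hFG HA HB in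
/-- **`¬ C23L47 rel mono Φ` on every two-block configuration** (reading R1 of «a ℘-binomial does not admit any non-zero
root parent» fails AS TYPED there). See `RootParentsPlatformSix.lean` for the platform `Gr^{3,6}`.
[cite: Hu2025, §4.2.2 remark after Ex. 4.14 ‹chunk 4.13› «a ℘-binomial does not admit any non-zero root parent», chunk p0023 l.47–48, p.50 L027 (unrefereed preprint arXiv:2507.21400v1 under adjudication, D-0012/D-0089 — kernel countermodel to OUR typed renderings `C23L47`/`C23L47_R2` of row 103 on a configuration the platform realises; nothing of the source asserted)] -/
theorem not_C23L47_of_config : ¬ C23L47 (k := k) (σ := σ) rel mono Φ := by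
  obtain ⟨hb, hne0, hroot, -⟩ := rootWitness_spec (k := k) rel mono Φ hij hg hiΦ hgΦ hne hgne hFG hmi hmj hmg₀ hmg₁
    hca hq₁a hq₂a hpq₁ hpq₂ hpc HA HB
  exact fun h => hne0 (h _ hb _ hroot)

include hij hg hiΦ hgΦ hmi hmj hmg₀ hmg₁ hca hq₁a hq₂a hpq₁ hpq₂ hpc hne hgne hFG HA HB in
/-- **`¬ C23L47_R2 rel mono Φ` on every two-block configuration** (reading R2, term-wise parents in `R_Φ`, fails AS
TYPED there too).
[cite: Hu2025, §4.2.2 remark after Ex. 4.14 ‹chunk 4.13› «a ℘-binomial does not admit any non-zero root parent», chunk p0023 l.47–48, p.50 L027 (unrefereed preprint arXiv:2507.21400v1 under adjudication, D-0012/D-0089 — kernel countermodel to OUR typed renderings `C23L47`/`C23L47_R2` of row 103 on a configuration the platform realises; nothing of the source asserted)] -/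
theorem not_C23L47_R2_of_config : ¬ C23L47_R2 (k := k) (σ := σ) rel mono Φ := by
  obtain ⟨hb, hne0, -, hroot⟩ := rootWitness_spec (k := k) rel mono Φ hij hg hiΦ hgΦ hne hgne hFG hmi hmj hmg₀ hmg₁
    hca hq₁a hq₂a hpq₁ hpq₂ hpc HA HB
  exact fun h => hne0 (h _ hb _ hroot)

end Config

end Literature.AlgebraicGeometry.Hu2025.Proofs.S04ModelV

end
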